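import Literature.ModelTheory.FiniteModelTheory.CPTCardProgram
import HarnessLib

/-!
# Isomorphism invariance of bounded BGS programs with counting (proved)

Topic `Literature/ModelTheory/FiniteModelTheory`; companion of `CPTCardProgram.lean`. We PROVE
that a PTime-bounded BGS+`Card` program accepts (rejects) a finite graph iff it accepts
(rejects) every isomorphic graph — Blass–Gurevich–
Shelah's "machines [that] do not distinguish between isomorphic structures" (1999, abstract,
§4.3). The proof is the evident EQUIVARIANCE of the whole semantics under a relabelling
`e : Fin n ≃ Fin m` of the atoms carrying `G` onto `H`:

* objects move by `HF.map e` (a bijection preserving `∈`, atoms, the set-theoretic primitives,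
  `Card`, the truth values and connectives — `HFSets.lean`), states by
  `DynState.mapAlong e` (`f(ā) ↦ e · f(e⁻¹ · ā)`), environments by composition;
* `Term.eval_mapAlong` / `Args.eval_mapAlong` (mutual induction on the syntax): values are
  equivariant — the input predicate because `e` is an isomorphism, comprehension because
  `HF.map e` commutes with `filter`/`image`; `Rule.den_mapAlong`: update sets move by the
  injective `updMap e`, so consistency is invariant and `fire`, `Program.step`,
  `Program.stateAt` are equivariant (`stateAt_mapAlong`);
* critical and active objects correspond under `HF.map e` (`active_mapAlong_iff`), so the
  active sets of the two runs are images of each other and have the same `encard`; `Halt` and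
  `Output` take corresponding (hence equal Boolean) values; isomorphic `Fin n`, `Fin m` force
  `n = m`, so the bounds `p(n)`, `q(n)` agree.

Consequently every CPT+Card-definable class of finite graphs is isomorphism-closed
(`CPTCardDefinable.isIsoClosed`), as the interface `CPTInterface`/`GurevichLogic.sat_iso` of
`CPT.lean` demands of a logic.

## References

* A. Blass, Y. Gurevich, S. Shelah, *Choiceless polynomial time*, Ann. Pure Appl. Logic 100
  (1999) = arXiv:math/9705225, abstract and §4.3 (inputs up to isomorphism), §8 (automorphisms
  act on `HF(I)` and on runs).
* A. Dawar, D. Richerby, B. Rossman, Ann. Pure Appl. Logic 152 (2008), §3.3 ("Active(I) is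
  closed under all automorphisms of I").
-/

noncomputable section

namespace Literature.ModelTheory.FiniteModelTheory

namespace BGS

variable {n m : ℕ}

/-! ### Transport of states, Boolean primitives -/

/-- Transport of a state along a relabelling `e` of the atoms: `(e · S) f (ā) = e · S f (e⁻¹ · ā)`.
[Blass–Gurevich–Shelah 1999, §8 (automorphisms act on states)] [folklore] -/
def DynState.mapAlong (e : Fin n ≃ Fin m) (S : DynState n) : DynState m :=
  fun f args => HF.map e (S f (args.map (HF.map e.symm)))

/-- `List.map (HF.map e.symm) ∘ List.map (HF.map e) = id`. [folklore] -/
theorem map_map_symm_map (e : Fin n ≃ Fin m) (args : List (Obj n)) :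
    (args.map (HF.map e)).map (HF.map e.symm) = args := by
  rw [List.map_map]
  conv_rhs => rw [← List.map_id args]
  exact List.map_congr_left fun x _ => HF.map_symm_map e x

/-- `List.map (HF.map e) ∘ List.map (HF.map e.symm) = id`. [folklore] -/
theorem map_symm_map_map (e : Fin n ≃ Fin m) (args : List (Obj m)) :
    (args.map (HF.map e.symm)).map (HF.map e) = args := by
  rw [List.map_map]
  conv_rhs => rw [← List.map_id args]
  exact List.map_congr_left fun x _ => HF.map_map_symm e x

/-- The transported state at a transported location. [folklore] -/
theorem DynState.mapAlong_apply_map (e : Fin n ≃ Fin m) (S : DynState n) (f : ℕ)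
    (args : List (Obj n)) : S.mapAlong e f (args.map (HF.map e)) = HF.map e (S f args) := by
  rw [DynState.mapAlong, map_map_symm_map]

/-- The initial state is transported to the initial state. [folklore] -/
theorem DynState.mapAlong_init (e : Fin n ≃ Fin m) : (DynState.init n).mapAlong e = DynState.init m := by
  funext f args
  exact HF.map_empty e

/-- `Halt` of the transported state. [folklore] -/
theorem DynState.halt_mapAlong (e : Fin n ≃ Fin m) (S : DynState n) :
    (S.mapAlong e).halt = HF.map e S.halt := rfl

/-- `Output` of the transported state. [folklore] -/
theorem DynState.output_mapAlong (e : Fin n ≃ Fin m) (S : DynState n) :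
    (S.mapAlong e).output = HF.map e S.output := rfl

/-- `memB` is equivariant. [folklore] -/
theorem memB_map (e : Fin n ≃ Fin m) (x s : Obj n) :
    memB (HF.map e x) (HF.map e s) = HF.map e (memB x s) := by
  classical
  unfold memB
  rw [HF.map_ofBool]
  congr 1
  exact decide_eq_decide.mpr (HF.map_mem_map_iff e)

/-- `eqB` is equivariant. [folklore] -/
theorem eqB_map (e : Fin n ≃ Fin m) (x y : Obj n) :
    eqB (HF.map e x) (HF.map e y) = HF.map e (eqB x y) := by
  unfold eqB
  rw [HF.map_ofBool]
  congr 1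
  exact decide_eq_decide.mpr (HF.map_injective e).eq_iff

/-- The input predicate is equivariant along an ISOMORPHISM. [folklore] -/
theorem edgeB_map (e : Fin n ≃ Fin m) {G : SimpleGraph (Fin n)} {H : SimpleGraph (Fin m)}
    (hGH : ∀ a b, G.Adj a b ↔ H.Adj (e a) (e b)) (x y : Obj n) :
    edgeB H (HF.map e x) (HF.map e y) = HF.map e (edgeB G x y) := by
  classical
  unfold edgeB
  rw [HF.map_ofBool]
  congr 1
  refine decide_eq_decide.mpr ⟨?_, ?_⟩
  · rintro ⟨a', b', hx, hy, hadj⟩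
    refine ⟨e.symm a', e.symm b', ?_, ?_, ?_⟩
    · rw [← HF.map_symm_map e x, hx, HF.map_atom]
    · rw [← HF.map_symm_map e y, hy, HF.map_atom]
    · rwa [hGH, Equiv.apply_symm_apply, Equiv.apply_symm_apply]
  · rintro ⟨a, b, rfl, rfl, hadj⟩
    exact ⟨e a, e b, rfl, rfl, (hGH a b).mp hadj⟩

/-! ### Equivariance of values and update sets -/

section Equivariance

variable (e : Fin n ≃ Fin m) {G : SimpleGraph (Fin n)} {H : SimpleGraph (Fin m)} (φ : G ≃g H)
  (S : DynState n)

/-- Transported environments, updated. [folklore] -/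
theorem update_map_comp (σ : Env n) (v : ℕ) (a : Obj n) :
    Function.update (HF.map e ∘ σ) v (HF.map e a) = HF.map e ∘ Function.update σ v a :=
  (Function.comp_update _ _ _ _).symm

mutual
/-- **Values of terms are equivariant**: evaluating in the transported state and environment on
the isomorphic graph gives the transported value. [Blass–Gurevich–Shelah 1999, §4.3, §8]
[folklore] -/
theorem Term.eval_mapAlong : ∀ (t : Term) (σ : Env n),
    t.eval H (S.mapAlong φ.toEquiv) (HF.map φ.toEquiv ∘ σ) = HF.map φ.toEquiv (t.eval G S σ)
  | .var _, _ => rfl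
  | .empty, _ => (HF.map_empty φ.toEquiv).symm
  | .atoms, _ => (HF.map_atoms φ.toEquiv).symm
  | .sUnion t, σ => by rw [Term.eval, Term.eval, Term.eval_mapAlong t σ, HF.map_sUnion]
  | .theUnique t, σ => by rw [Term.eval, Term.eval, Term.eval_mapAlong t σ, HF.map_theUnique]
  | .pair s t, σ => by
    rw [Term.eval, Term.eval, Term.eval_mapAlong s σ, Term.eval_mapAlong t σ, HF.map_pair]
  | .card t, σ => by rw [Term.eval, Term.eval, Term.eval_mapAlong t σ, HF.map_card]
  | .mem s t, σ => by
    rw [Term.eval, Term.eval, Term.eval_mapAlong s σ, Term.eval_mapAlong t σ, memB_map]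
  | .eq s t, σ => by
    rw [Term.eval, Term.eval, Term.eval_mapAlong s σ, Term.eval_mapAlong t σ, eqB_map]
  | .cTrue, _ => (HF.map_ofBool φ.toEquiv true).symm
  | .cFalse, _ => (HF.map_ofBool φ.toEquiv false).symm
  | .not t, σ => by rw [Term.eval, Term.eval, Term.eval_mapAlong t σ, HF.map_bnot]
  | .and s t, σ => by
    rw [Term.eval, Term.eval, Term.eval_mapAlong s σ, Term.eval_mapAlong t σ, HF.map_band]
  | .or s t, σ => by
    rw [Term.eval, Term.eval, Term.eval_mapAlong s σ, Term.eval_mapAlong t σ, HF.map_bor]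
  | .edge s t, σ => by
    rw [Term.eval, Term.eval, Term.eval_mapAlong s σ, Term.eval_mapAlong t σ,
      edgeB_map φ.toEquiv (fun a b => φ.map_adj_iff.symm)]
  | .dyn f args, σ => by
    rw [Term.eval, Term.eval, Args.eval_mapAlong args σ, DynState.mapAlong_apply_map]
  | .compr v t r g, σ => by
    have ihg : ∀ a, g.eval H (S.mapAlong φ.toEquiv) (HF.map φ.toEquiv ∘ Function.update σ v a) =
        HF.map φ.toEquiv (g.eval G S (Function.update σ v a)) := fun a => Term.eval_mapAlong g _
    have iht : ∀ a, t.eval H (S.mapAlong φ.toEquiv) (HF.map φ.toEquiv ∘ Function.update σ v a) =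
        HF.map φ.toEquiv (t.eval G S (Function.update σ v a)) := fun a => Term.eval_mapAlong t _
    rw [Term.eval, Term.eval, Term.eval_mapAlong r σ, HF.members_map, Finset.filter_image,
      Finset.image_image, HF.map_ofFinset, Finset.image_image]
    congr 1
    ext y
    simp only [Finset.mem_image, Finset.mem_filter, Function.comp_apply, update_map_comp, ihg,
      iht, HF.map_eq_ofBool_iff]
/-- Values of argument lists are equivariant. [folklore] -/
theorem Args.eval_mapAlong : ∀ (args : Args) (σ : Env n),
    args.eval H (S.mapAlong φ.toEquiv) (HF.map φ.toEquiv ∘ σ) = (args.eval G S σ).map (HF.map φ.toEquiv)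
  | .nil, _ => rfl
  | .cons t rest, σ => by
    rw [Args.eval, Args.eval, Term.eval_mapAlong t σ, Args.eval_mapAlong rest σ, List.map_cons]
end

/-- Transport of updates. [folklore] -/
def updMap (u : Update n) : Update m := ((u.1.1, u.1.2.map (HF.map e)), HF.map e u.2)

/-- `updMap` is injective. [folklore] -/
theorem updMap_injective : Function.Injective (updMap e) := by
  rintro ⟨⟨f, args⟩, b⟩ ⟨⟨f', args'⟩, b'⟩ h
  simp only [updMap, Prod.mk.injEq] at h
  obtain ⟨⟨rfl, hargs⟩, hb⟩ := h
  have : args = args' := by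
    rw [← map_map_symm_map e args, hargs, map_map_symm_map]
  rw [this, HF.map_injective e hb]

/-- Locations are transported injectively. [folklore] -/
theorem updMap_fst_injective {u u' : Update n} (h : (updMap e u).1 = (updMap e u').1) :
    u.1 = u'.1 := by
  obtain ⟨⟨f, args⟩, b⟩ := u
  obtain ⟨⟨f', args'⟩, b'⟩ := u'
  simp only [updMap, Prod.mk.injEq] at h ⊢
  refine ⟨h.1, ?_⟩
  rw [← map_map_symm_map e args, h.2, map_map_symm_map]

/-- **Update sets are equivariant**: `Den(R)` in the transported data is the image of `Den(R)`
under `updMap e`. [Blass–Gurevich–Shelah 1999, §4.6, §8] [folklore] -/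
theorem Rule.den_mapAlong : ∀ (R : Rule) (σ : Env n),
    R.den H (S.mapAlong φ.toEquiv) (HF.map φ.toEquiv ∘ σ) = (R.den G S σ).image (updMap φ.toEquiv)
  | .skip, _ => by rw [Rule.den, Rule.den, Finset.image_empty]
  | .update f args t, σ => by
    rw [Rule.den, Rule.den, Finset.image_singleton, Args.eval_mapAlong φ S args σ,
      Term.eval_mapAlong φ S t σ]
    rfl
  | .cond g R₁ R₂, σ => by
    rw [Rule.den, Rule.den, Term.eval_mapAlong φ S g σ]
    by_cases h : Term.eval G S g σ = HF.ofBool true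
    · rw [if_pos ((HF.map_eq_ofBool_iff φ.toEquiv).mpr h), if_pos h]
      exact Rule.den_mapAlong R₁ σ
    · rw [if_neg (fun h' => h ((HF.map_eq_ofBool_iff φ.toEquiv).mp h')), if_neg h]
      exact Rule.den_mapAlong R₂ σ
  | .forallDo v r R, σ => by
    rw [Rule.den, Rule.den, Term.eval_mapAlong φ S r σ, HF.members_map, Finset.image_biUnion,
      Finset.biUnion_image]
    refine Finset.biUnion_congr rfl fun a _ => ?_
    rw [update_map_comp, Rule.den_mapAlong R (Function.update σ v a)]

/-- Consistency is invariant under transport. [folklore] -/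
theorem consistent_image_iff (U : Finset (Update n)) :
    Consistent (U.image (updMap e)) ↔ Consistent U := by
  constructor
  · intro h u hu u' hu' hl
    have := h _ (Finset.mem_image_of_mem _ hu) _ (Finset.mem_image_of_mem _ hu')
      (by simp only [updMap, hl])
    exact HF.map_injective e this
  · intro h w hw w' hw' hl
    obtain ⟨u, hu, rfl⟩ := Finset.mem_image.mp hw
    obtain ⟨u', hu', rfl⟩ := Finset.mem_image.mp hw'
    have := h u hu u' hu' (updMap_fst_injective e hl)
    simp only [updMap, this]

/-- **Firing is equivariant.** [Blass–Gurevich–Shelah 1999, §4.6, §8] [folklore] -/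
theorem fire_mapAlong (U : Finset (Update n)) :
    fire (S.mapAlong e) (U.image (updMap e)) = (fire S U).mapAlong e := by
  funext f args'
  by_cases hU : Consistent U
  · have hU' : Consistent (U.image (updMap e)) := (consistent_image_iff e U).mpr hU
    -- the location `(f, args')` is the transport of `(f, args)`
    set args : List (Obj n) := args'.map (HF.map e.symm) with hargs
    have hargs' : args' = args.map (HF.map e) := (map_symm_map_map e args').symm
    by_cases hex : ∃ b, ((f, args), b) ∈ U
    · obtain ⟨b, hb⟩ := hex
      have hmem : ((f, args'), HF.map e b) ∈ U.image (updMap e) := by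
        rw [hargs']
        exact Finset.mem_image.mpr ⟨((f, args), b), hb, rfl⟩
      rw [fire_apply_of_mem hU' hmem, DynState.mapAlong, ← hargs, fire_apply_of_mem hU hb]
    · have hno : ∀ b, ((f, args), b) ∉ U := fun b hb => hex ⟨b, hb⟩
      have hno' : ∀ b', ((f, args'), b') ∉ U.image (updMap e) := by
        intro b' hb'
        obtain ⟨⟨⟨f₀, args₀⟩, b₀⟩, hu, hu'⟩ := Finset.mem_image.mp hb'
        simp only [updMap, Prod.mk.injEq] at hu'
        obtain ⟨⟨rfl, h₀⟩, -⟩ := hu'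
        have : args₀ = args := by rw [hargs, ← h₀, map_map_symm_map]
        exact hno b₀ (this ▸ hu)
      rw [fire_apply_of_forall_not_mem hno', DynState.mapAlong, DynState.mapAlong, ← hargs,
        fire_apply_of_forall_not_mem hno]
  · have hU' : ¬ Consistent (U.image (updMap e)) := fun h => hU ((consistent_image_iff e U).mp h)
    rw [fire_of_not_consistent hU, fire_of_not_consistent hU']

/-- **One step is equivariant.** [Blass–Gurevich–Shelah 1999, §4.7, §8] [folklore] -/
theorem Program.step_mapAlong (P : Program) :
    P.step H (S.mapAlong φ.toEquiv) = (P.step G S).mapAlong φ.toEquiv := by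
  have henv : (fun _ => ∅ : Env m) = HF.map φ.toEquiv ∘ (fun _ => (∅ : Obj n)) :=
    funext fun _ => (HF.map_empty φ.toEquiv).symm
  rw [Program.step, Program.step, henv, Rule.den_mapAlong φ S, fire_mapAlong]

end Equivariance

section Run

variable (e : Fin n ≃ Fin m) {G : SimpleGraph (Fin n)} {H : SimpleGraph (Fin m)} (φ : G ≃g H)

/-- **The run is equivariant**: the `i`-th state on `H` is the transport of the `i`-th state on
`G`. [Blass–Gurevich–Shelah 1999, §8] [folklore] -/
theorem Program.stateAt_mapAlong (P : Program) : ∀ i : ℕ,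
    P.stateAt H i = (P.stateAt G i).mapAlong φ.toEquiv
  | 0 => (DynState.mapAlong_init φ.toEquiv).symm
  | i + 1 => by
    rw [Program.stateAt_succ, Program.stateAt_succ, Program.stateAt_mapAlong P i,
      Program.step_mapAlong φ]

include φ in
/-- Halting stages agree on isomorphic inputs. [folklore] -/
theorem Program.haltsAt_iff_of_iso (P : Program) (l : ℕ) : P.HaltsAt H l ↔ P.HaltsAt G l := by
  have key : ∀ i, (P.stateAt H i).halt = HF.ofBool true ↔ (P.stateAt G i).halt = HF.ofBool true := by
    intro i
    rw [P.stateAt_mapAlong φ i, DynState.halt_mapAlong, HF.map_eq_ofBool_iff]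
  simp only [Program.HaltsAt, Ne, key]

include φ in
/-- Outputs agree on isomorphic inputs. [folklore] -/
theorem Program.output_eq_iff_of_iso (P : Program) (l : ℕ) (b : Bool) :
    (P.stateAt H l).output = HF.ofBool b ↔ (P.stateAt G l).output = HF.ofBool b := by
  rw [P.stateAt_mapAlong φ l, DynState.output_mapAlong, HF.map_eq_ofBool_iff]

/-- Critical objects correspond under transport. [Blass–Gurevich–Shelah 1999, §5.1, §8]
[folklore] -/
theorem DynState.critical_mapAlong_iff (S : DynState n) (x : Obj n) :
    (S.mapAlong e).Critical (HF.map e x) ↔ S.Critical x := by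
  unfold DynState.Critical
  refine or_congr (HF.isAtom_map_iff e) (or_congr (HF.isBool_map_iff e) (or_congr ?_ ?_))
  · constructor
    · rintro ⟨f, args', h⟩
      exact ⟨f, args'.map (HF.map e.symm), HF.map_injective e h⟩
    · rintro ⟨f, args, h⟩
      exact ⟨f, args.map (HF.map e), by rw [DynState.mapAlong_apply_map, h]⟩
  · constructor
    · rintro ⟨f, args', hne, hx⟩
      refine ⟨f, args'.map (HF.map e.symm), fun h => hne ?_, ?_⟩
      · show HF.map e (S f (args'.map (HF.map e.symm))) = ∅
        rw [h, HF.map_empty]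
      · exact List.mem_map.mpr ⟨HF.map e x, hx, HF.map_symm_map e x⟩
    · rintro ⟨f, args, hne, hx⟩
      refine ⟨f, args.map (HF.map e), fun h => hne ?_, List.mem_map.mpr ⟨x, hx, rfl⟩⟩
      rw [DynState.mapAlong_apply_map] at h
      exact HF.map_injective e (h.trans (HF.map_empty e).symm)

/-- Active objects correspond under transport. [Blass–Gurevich–Shelah 1999, §5.1, §8;
Dawar–Richerby–Rossman 2008, §3.3] [folklore] -/
theorem DynState.active_mapAlong_iff (S : DynState n) (x : Obj n) :
    (S.mapAlong e).Active (HF.map e x) ↔ S.Active x := by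
  constructor
  · rintro ⟨y', hy', hxy'⟩
    obtain ⟨y, rfl⟩ : ∃ y, HF.map e y = y' := ⟨HF.map e.symm y', HF.map_map_symm e y'⟩
    refine ⟨y, (DynState.critical_mapAlong_iff e S y).mp hy', ?_⟩
    rcases hxy' with h | h
    · exact Or.inl (HF.map_injective e h)
    · rw [HF.tc_map, Finset.mem_image] at h
      obtain ⟨z, hz, hzx⟩ := h
      exact Or.inr (HF.map_injective e hzx ▸ hz)
  · rintro ⟨y, hy, hxy⟩
    refine ⟨HF.map e y, (DynState.critical_mapAlong_iff e S y).mpr hy, ?_⟩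
    rcases hxy with rfl | h
    · exact Or.inl rfl
    · exact Or.inr (by rw [HF.tc_map]; exact Finset.mem_image_of_mem _ h)

/-- The active set of the run on `H` is the transport of the active set of the run on `G`.
[Blass–Gurevich–Shelah 1999, §8] [folklore] -/
theorem Program.activeSet_eq_image (P : Program) (l : ℕ) :
    P.activeSet H l = HF.map φ.toEquiv '' P.activeSet G l := by
  ext x'
  obtain ⟨x, rfl⟩ : ∃ x, HF.map φ.toEquiv x = x' :=
    ⟨HF.map φ.toEquiv.symm x', HF.map_map_symm φ.toEquiv x'⟩
  rw [(HF.map_injective φ.toEquiv).mem_set_image]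
  simp only [Program.activeSet, Set.mem_setOf_eq, P.stateAt_mapAlong φ,
    DynState.active_mapAlong_iff]

include φ in
/-- Hence the two runs activate the same number of objects. [folklore] -/
theorem Program.encard_activeSet_eq (P : Program) (l : ℕ) :
    (P.activeSet H l).encard = (P.activeSet G l).encard := by
  rw [P.activeSet_eq_image φ, (HF.map_injective φ.toEquiv).encard_image]

end Run

end BGS

/-- **Isomorphism invariance of CPT+Card programs**: a PTime-bounded BGS program with counting
accepts (rejects) a finite graph iff it accepts (rejects) any isomorphic one — the machines "do
not distinguish between isomorphic structures". [Blass–Gurevich–Shelah 1999, abstract and §4.3;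
Dawar–Richerby–Rossman 2008, §3.3] [folklore] -/
theorem CPTCardProgram.accepts_rejects_iff_of_iso (P : CPTCardProgram) {n m : ℕ}
    (G : SimpleGraph (Fin n)) (H : SimpleGraph (Fin m)) (hiso : Nonempty (G ≃g H)) :
    (P.Accepts ⟨n, G⟩ ↔ P.Accepts ⟨m, H⟩) ∧ (P.Rejects ⟨n, G⟩ ↔ P.Rejects ⟨m, H⟩) := by
  obtain ⟨iso⟩ := hiso
  obtain rfl : n = m := Fin.equiv_iff_eq.mp ⟨iso.toEquiv⟩
  have hH : ∀ l, P.prog.HaltsAt H l ↔ P.prog.HaltsAt G l := fun l =>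
    BGS.Program.haltsAt_iff_of_iso iso P.prog l
  have hA : ∀ l, (P.prog.activeSet H l).encard = (P.prog.activeSet G l).encard := fun l =>
    BGS.Program.encard_activeSet_eq iso P.prog l
  have hO : ∀ l b, (P.prog.stateAt H l).output = HF.ofBool b ↔
      (P.prog.stateAt G l).output = HF.ofBool b := fun l b =>
    BGS.Program.output_eq_iff_of_iso iso P.prog l b
  constructor
  · simp only [CPTCardProgram.Accepts, hH, hA, hO]
  · simp only [CPTCardProgram.Rejects, hH, hA, hO]

/-- The class of graphs accepted by a bounded program is isomorphism-closed. [Blass–Gurevich–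
Shelah 1999, §1] [folklore] -/
theorem CPTCardProgram.isIsoClosed_setOf_accepts (P : CPTCardProgram) :
    IsIsoClosed {G | P.Accepts G} := fun _ _ G H h =>
  (P.accepts_rejects_iff_of_iso G H h).1

/-- The class of graphs rejected by a bounded program is isomorphism-closed. [Blass–Gurevich–
Shelah 1999, §1] [folklore] -/
theorem CPTCardProgram.isIsoClosed_setOf_rejects (P : CPTCardProgram) :
    IsIsoClosed {G | P.Rejects G} := fun _ _ G H h =>
  (P.accepts_rejects_iff_of_iso G H h).2

/-- **CPT+Card-definable classes of finite graphs are isomorphism-closed.** [Blass–Gurevich–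
Shelah 1999, §1] [folklore] -/
theorem CPTCardDefinable.isIsoClosed {C : Set FinGraph} (h : CPTCardDefinable C) :
    IsIsoClosed C := by
  obtain ⟨P, hP⟩ := h
  rw [← hP.setOf_accepts_eq]
  exact P.isIsoClosed_setOf_accepts

end Literature.ModelTheory.FiniteModelTheory
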